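/-
Copyright (c) 2026 the pub-hodgecm-mathlib formalisation cell (harness21).  Prover seat hodgecm-mathlib-F0P2-p09 (g2), Track B «K2-LIT»,
#184♮ = hLiu418 = `stmt-HodgeConjecture-24832`; socket #41, KIND 1 (K1-b♮), brick (ρ6a) (B-i) — LEAD F0P6-plan (g14) BATCH #172 (1) (R90-C10-p03 (g0)'s (ρ6a) split;
desk K2Liu-p14 (g4) ∕ R90-C10-p03).  THEOREMS ONLY (no `def`, no `instance`, no notation, no named-fact hypothesis, no `sorry`).
-/
import Literature.NumberTheory.Automorphic.AdelicVectorHeight   -- ★ `vecHeight`, `vecFinHeight`, `vecArchNorm`, `principalVec`, `isHeightFinite_principalVec`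
import Mathlib.NumberTheory.Height.NumberField                   -- Mathlib `Height.mulHeight`, `NumberField.mulHeight_eq`
import HarnessLib

/-!
# Crux `HLiu418`, socket #41, KIND 1, brick (ρ6a) (B-i): THE TREE↔MATHLIB HEIGHT BRIDGE — `vecHeight K (principalVec K ξ) ≤ (#ι)^{[K:ℚ]} · Height.mulHeight ξ`

Cell `hodgecm-mathlib`, crux item hLiu418 = `stmt-HodgeConjecture-24832` (helper lane `--supports … --as helper`, count-neutral), route of record `HCCMUnconditional`;
squad K2 ∕ K2Liu (L1, LEAD F0P6-plan (g14)), road `K2_Liu`, socket #41, KIND 1, organ (K1b-♮) (desk K2Liu-p14 (g4)): (ρ6a) bounds the adelic height of the Levi element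
`Λγ[w]` by the Godement–Garrett height of the principal adelic vector of `w` (★ `Literature.NumberTheory.Automorphic.AdelicVectorHeight.vecHeight`), while (ρ6b)
★ `K2LiuRankOneLineProjectiveHeight` speaks Mathlib's projective height `Height.mulHeight`; THIS FILE is the bridge (B-i) between the two currencies.
NORMALISATIONS ([Godement1964, §1.1–§1.2], [Garrett2018, §2.2], [BombieriGubler2006, §1.5]).  ★ `vecHeight K x = ∏_{w∣∞} vecArchNorm_w(x)^{mult w} · ∏ᶠ_v vecFinHeight_v(x)` with
the EUCLIDEAN norm `vecArchNorm_w(x) = (∑ᵢ ‖xᵢ,w‖²)^{1/2}` at an infinite place and the SUP norm `vecFinHeight_v(x) = maxᵢ ‖xᵢ,v‖` at a finite place (Mathlib's norms on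
`w.Completion` and `v.adicCompletion K`); Mathlib `NumberField.mulHeight_eq`: `mulHeight ξ = ∏_{v∣∞} (maxᵢ v(ξᵢ))^{mult v} · ∏ᶠ_{v∤∞} maxᵢ v(ξᵢ)` with the SAME absolute values
(`‖(ξ : w.Completion)‖ = w ξ`, Mathlib `InfinitePlace.Completion.norm_coe`; `‖(ξ : K_v)‖ = FinitePlace.mk v ξ`, Mathlib `FinitePlace.equivHeightOneSpectrum_symm_apply`).  Hence the
finite parts AGREE (`coe_finprod_vecFinHeight_principalVec`) and at each infinite place `max ≤ euclid ≤ √#ι · max ≤ #ι · max` (`coe_vecArchNorm_principalVec_le`), so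
**`vecHeight K (principalVec K ξ) ≤ (#ι)^{Σ mult} · mulHeight ξ = (#ι)^{[K:ℚ]} · mulHeight ξ`** (`k = 1`, `C = (#ι)^{[K:ℚ]}`; Mathlib `InfinitePlace.sum_mult_eq`).
HONEST LABEL.  Count-neutral helper; closes no socket by itself; `HC_CM` is proved only modulo the 7 printed citations (2 remaining named inputs:
hLiu418 = `stmt-HodgeConjecture-24832`, h413 = `stmt-HodgeConjecture-24833`) until rung 0 closes.

## References
* [Godement1964] R. Godement, *Domaines fondamentaux des groupes arithmétiques*, Sém. Bourbaki 8 (1962/63), Exp. 257, 201–225 (SMF 1964): §1.1–§1.2 (heights of adelic vectors).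
* [Garrett2018] P. Garrett, *Modern Analysis of Automorphic Forms by Example* (2018): §2.2 (PDF pp. 81–82).
* [BombieriGubler2006] E. Bombieri, W. Gubler, *Heights in Diophantine Geometry* (2006): §1.5 (the projective height and its normalisations).
-/

set_option autoImplicit false
-- the mandated namespace repeats the single-problem summit's segment (`HodgeConjecture.HodgeConjecture`)
set_option linter.dupNamespace false

noncomputable section

open scoped NNReal
open NumberField NumberField.InfinitePlace IsDedekindDomain Height
open Literature.NumberTheory.Automorphic

namespace Summit.HodgeConjecture.HodgeConjecture.Cruxes.HLiu418.K2LiuVecHeightVsMulHeight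

variable (K : Type) [Field K] [NumberField K] {ι : Type*} [Fintype ι]

/-! ## §1 Local matching: finite places agree, archimedean Euclidean norm ≤ `#ι ·` sup norm -/

omit [Fintype ι] in
/-- the `v`-component of the principal adele of `x` is `x ∈ K_v` (Mathlib `IsDedekindDomain.FiniteAdeleRing.algebraMap_apply`). [cite: Garrett2018, §2.2 (PDF p. 81)] -/
theorem snd_principalVec_apply (ξ : ι → K) (i : ι) (v : HeightOneSpectrum (𝓞 K)) :
    (principalVec K ξ i).2 v = ((ξ i : K) : v.adicCompletion K) :=
  IsDedekindDomain.FiniteAdeleRing.algebraMap_apply (𝓞 K) K (ξ i) v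

omit [Fintype ι] in
/-- `‖(principalVec ξ)ᵢ,w‖ = w(ξᵢ)` at an infinite place (Mathlib `InfinitePlace.Completion.norm_coe`). [cite: Garrett2018, §2.2 (PDF p. 81)] -/
theorem norm_fst_principalVec_apply (ξ : ι → K) (i : ι) (w : InfinitePlace K) : ‖(principalVec K ξ i).1 w‖ = w (ξ i) := by
  rw [show (principalVec K ξ i).1 w = ((ξ i : K) : w.Completion) from rfl, InfinitePlace.Completion.norm_coe]
  rfl

/-- **THE FINITE LOCAL HEIGHTS AGREE**: `vecFinHeight_v(ξ) = maxᵢ |ξᵢ|_v` for Mathlib's finite place attached to `v`. [cite: Garrett2018, §2.2 (PDF p. 81)] [cite: BombieriGubler2006, §1.5] -/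
theorem coe_vecFinHeight_principalVec (v : HeightOneSpectrum (𝓞 K)) (ξ : ι → K) :
    ((vecFinHeight K v (principalVec K ξ) : ℝ≥0) : ℝ) = ⨆ i, (FinitePlace.equivHeightOneSpectrum.symm v) (ξ i) := by
  rw [vecFinHeight, Finset.sup_univ_eq_ciSup, NNReal.coe_iSup]
  refine iSup_congr fun i => ?_
  rw [FinitePlace.equivHeightOneSpectrum_symm_apply, coe_nnnorm, snd_principalVec_apply]
  rfl

/-- **THE FINITE PARTS AGREE**: `∏ᶠ_v vecFinHeight_v(ξ) = ∏ᶠ_{w finite} maxᵢ w(ξᵢ)` for `ξ ≠ 0` (reindexing by Mathlib `FinitePlace.equivHeightOneSpectrum`; the finite support is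
★ `isHeightFinite_principalVec`). [cite: Garrett2018, §2.2 (PDF p. 82)] [cite: BombieriGubler2006, §1.5] -/
theorem coe_finprod_vecFinHeight_principalVec {ξ : ι → K} (hξ : ξ ≠ 0) :
    ((∏ᶠ v : HeightOneSpectrum (𝓞 K), vecFinHeight K v (principalVec K ξ) : ℝ≥0) : ℝ) = ∏ᶠ w : FinitePlace K, ⨆ i, w (ξ i) := by
  have hmap := (NNReal.toRealHom.toMonoidHom).map_finprod (isHeightFinite_principalVec (K := K) hξ)
  simp only [RingHom.toMonoidHom_eq_coe, MonoidHom.coe_coe, NNReal.coe_toRealHom] at hmap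
  rw [hmap, ← finprod_comp_equiv (FinitePlace.equivHeightOneSpectrum (K := K)).symm]
  exact finprod_congr fun v => coe_vecFinHeight_principalVec K v ξ

/-- **THE ARCHIMEDEAN EUCLIDEAN NORM IS AT MOST `#ι ·` THE SUP NORM**: `vecArchNorm_w(ξ) = (∑ᵢ w(ξᵢ)²)^{1/2} ≤ √#ι · maxᵢ w(ξᵢ) ≤ #ι · maxᵢ w(ξᵢ)`.
[cite: Godement1964, §1.1] [cite: BombieriGubler2006, §1.5] -/
theorem coe_vecArchNorm_principalVec_le (w : InfinitePlace K) (ξ : ι → K) :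
    ((vecArchNorm K w (principalVec K ξ) : ℝ≥0) : ℝ) ≤ (Fintype.card ι : ℝ) * ⨆ i, w (ξ i) := by
  set M : ℝ≥0 := Finset.univ.sup fun i => ‖(principalVec K ξ i).1 w‖₊ with hM
  have hle : ∀ i, ‖(principalVec K ξ i).1 w‖₊ ≤ M := fun i => Finset.le_sup (f := fun i => ‖(principalVec K ξ i).1 w‖₊) (Finset.mem_univ i)
  have hsum : (∑ i, ‖(principalVec K ξ i).1 w‖₊ ^ 2) ≤ (Fintype.card ι : ℝ≥0) * M ^ 2 := by
    have h := Finset.sum_le_card_nsmul (Finset.univ : Finset ι) (fun i => ‖(principalVec K ξ i).1 w‖₊ ^ 2) (M ^ 2)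
      fun i _ => pow_le_pow_left' (hle i) 2
    rwa [Finset.card_univ, nsmul_eq_mul] at h
  have hcard : NNReal.sqrt (Fintype.card ι : ℝ≥0) ≤ (Fintype.card ι : ℝ≥0) := by
    rw [NNReal.sqrt_le_iff_le_sq, sq]
    rcases Nat.eq_zero_or_pos (Fintype.card ι) with h0 | hpos
    · rw [h0, Nat.cast_zero, mul_zero]
    · exact le_mul_of_one_le_right (Nat.cast_nonneg _) (by exact_mod_cast hpos)
  have hN : vecArchNorm K w (principalVec K ξ) ≤ (Fintype.card ι : ℝ≥0) * M := by
    rw [vecArchNorm]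
    calc NNReal.sqrt (∑ i, ‖(principalVec K ξ i).1 w‖₊ ^ 2) ≤ NNReal.sqrt ((Fintype.card ι : ℝ≥0) * M ^ 2) := NNReal.sqrt_le_sqrt.2 hsum
      _ = NNReal.sqrt (Fintype.card ι : ℝ≥0) * M := by rw [NNReal.sqrt_mul, NNReal.sqrt_sq]
      _ ≤ (Fintype.card ι : ℝ≥0) * M := mul_le_mul_left hcard M
  have hMR : ((M : ℝ≥0) : ℝ) = ⨆ i, w (ξ i) := by
    rw [hM, Finset.sup_univ_eq_ciSup, NNReal.coe_iSup]
    refine iSup_congr fun i => ?_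
    rw [coe_nnnorm, norm_fst_principalVec_apply]
  have h := NNReal.coe_le_coe.2 hN
  rwa [NNReal.coe_mul, NNReal.coe_natCast, hMR] at h

/-! ## §2 The bridge -/

/-- **(ρ6a) (B-i) THE TREE↔MATHLIB HEIGHT BRIDGE**: for a non-zero rational vector `ξ : ι → K`, the Godement–Garrett height of its principal adelic vector is at most
`(#ι)^{[K:ℚ]}` times Mathlib's projective height: **`vecHeight K (principalVec K ξ) ≤ (Fintype.card ι) ^ finrank ℚ K · Height.mulHeight ξ`** (finite parts equal, each archimedean
factor `≤ (#ι · max)^{mult w}`, `∑_w mult w = [K:ℚ]`). [cite: Godement1964, §1.1–§1.2] [cite: Garrett2018, §2.2 (PDF pp. 81–82)] [cite: BombieriGubler2006, §1.5] -/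
theorem coe_vecHeight_principalVec_le_mulHeight {ξ : ι → K} (hξ : ξ ≠ 0) :
    ((vecHeight K (principalVec K ξ) : ℝ≥0) : ℝ) ≤ (Fintype.card ι : ℝ) ^ Module.finrank ℚ K * mulHeight ξ := by
  rw [vecHeight, NNReal.coe_mul, coe_finprod_vecFinHeight_principalVec K hξ, NumberField.mulHeight_eq hξ, NNReal.coe_prod]
  have hsup0 : ∀ v : InfinitePlace K, 0 ≤ ⨆ i, v (ξ i) := fun v => Real.iSup_nonneg fun i => apply_nonneg v (ξ i)
  have harch : (∏ w : InfinitePlace K, ((vecArchNorm K w (principalVec K ξ) ^ w.mult : ℝ≥0) : ℝ)) ≤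
      ∏ w : InfinitePlace K, ((Fintype.card ι : ℝ) * ⨆ i, w (ξ i)) ^ w.mult := by
    refine Finset.prod_le_prod (fun w _ => NNReal.coe_nonneg _) fun w _ => ?_
    rw [NNReal.coe_pow]
    exact pow_le_pow_left₀ (NNReal.coe_nonneg _) (coe_vecArchNorm_principalVec_le K w ξ) _
  have hsplit : (∏ w : InfinitePlace K, ((Fintype.card ι : ℝ) * ⨆ i, w (ξ i)) ^ w.mult) =
      (Fintype.card ι : ℝ) ^ Module.finrank ℚ K * ∏ w : InfinitePlace K, (⨆ i, w (ξ i)) ^ w.mult := by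
    simp_rw [mul_pow]
    rw [Finset.prod_mul_distrib, Finset.prod_pow_eq_pow_sum, InfinitePlace.sum_mult_eq]
  have hfin0 : 0 ≤ ∏ᶠ w : FinitePlace K, ⨆ i, w (ξ i) := finprod_nonneg fun w => Real.iSup_nonneg fun i => apply_nonneg w (ξ i)
  calc (∏ w : InfinitePlace K, ((vecArchNorm K w (principalVec K ξ) ^ w.mult : ℝ≥0) : ℝ)) * ∏ᶠ w : FinitePlace K, ⨆ i, w (ξ i)
      ≤ ((Fintype.card ι : ℝ) ^ Module.finrank ℚ K * ∏ w : InfinitePlace K, (⨆ i, w (ξ i)) ^ w.mult) * ∏ᶠ w : FinitePlace K, ⨆ i, w (ξ i) :=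
        mul_le_mul_of_nonneg_right (harch.trans hsplit.le) hfin0
    _ = (Fintype.card ι : ℝ) ^ Module.finrank ℚ K * ((∏ w : InfinitePlace K, (⨆ i, w (ξ i)) ^ w.mult) * ∏ᶠ w : FinitePlace K, ⨆ i, w (ξ i)) := by
        rw [mul_assoc]

/-- the same with `k = 1` displayed as a power, the `(C, k)` shape of (ρ6a)'s interface: `vecHeight K (principalVec K ξ) ≤ C · mulHeight ξ ^ 1`. [cite: BombieriGubler2006, §1.5] -/
theorem coe_vecHeight_principalVec_le_mulHeight_pow {ξ : ι → K} (hξ : ξ ≠ 0) :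
    ((vecHeight K (principalVec K ξ) : ℝ≥0) : ℝ) ≤ (Fintype.card ι : ℝ) ^ Module.finrank ℚ K * mulHeight ξ ^ (1 : ℕ) := by
  rw [pow_one]
  exact coe_vecHeight_principalVec_le_mulHeight K hξ

/-- **THE `(C, k)` INTERFACE LETTER consumed by (ρ6a)(ii) ∕ (B-ii) (R90-C10-p03 (g0) 2026-09-04T23:52:58Z, verbatim shape)**: `∃ C k, 0 ≤ C ∧ ∀ ξ ≠ 0, vecHeight K (principalVec K ξ) ≤
C · mulHeight ξ ^ k` — witnessed by `C = (#ι)^{[K:ℚ]}`, `k = 1`. [cite: Godement1964, §1.1–§1.2] [cite: BombieriGubler2006, §1.5] -/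
theorem exists_vecHeight_principalVec_le_mulHeight_pow :
    ∃ C : ℝ, ∃ k : ℕ, 0 ≤ C ∧ ∀ ξ : ι → K, ξ ≠ 0 → ((vecHeight K (principalVec K ξ) : ℝ≥0) : ℝ) ≤ C * mulHeight ξ ^ k :=
  ⟨(Fintype.card ι : ℝ) ^ Module.finrank ℚ K, 1, by positivity, fun _ hξ => coe_vecHeight_principalVec_le_mulHeight_pow K hξ⟩

end Summit.HodgeConjecture.HodgeConjecture.Cruxes.HLiu418.K2LiuVecHeightVsMulHeight

end
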